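import Literature.AnabelianGeometry.EtaleTheta.Discharge.Sec4NonVacuityTowerRemark411
import Literature.AnabelianGeometry.EtaleTheta.Discharge.Sec4NonVacuityTowerConjThm44
import Literature.AnabelianGeometry.EtaleTheta.Discharge.Sec4Prop43iOfGaloisSurjNatural
import Literature.AnabelianGeometry.EtaleTheta.SettingModelChiSemidirect
import HarnessLib

/-!
# [EtTh] §4 over the GENUINE Kummer tower: the Def 4.1 (ii) laws, Prop 4.3 (i), L01a — and ALL typed §4 statements
# at ONE setting, including Rmk 4.1.1 and a `Ψ^bs ≠ 𝟭` Thm 4.4 (consistency witness, part 15 — complete picture)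

S. Mochizuki, *The étale theta function and its Frobenioid-theoretic manifestations*, Publ. RIMS **45**
(2009) [MochizukiEtTh2009], §4: Def 4.1 (ii) p.87 (`Π^tp_X ↠ Aut_D(A^bs)` with open kernel, natural in `A`),
Rmk 4.1.1 p.88, Prop 4.2 p.88, Prop 4.3 pp.90–91, Thm 4.4 pp.93–95 (PDF).

CONSISTENCY WITNESS, TOY — PROOF-ONLY (no definition, no named fact, no instance, no `sorry`); conclusion of the
`ToyTower` programme (parts 10–14: p438749 p439046 p439630 p440797 p442161 p445784 p445625).  Proved here:

* `ToyTower.galoisSurjNatural`, `ToyTower.isOpenKerGaloisSurj` — **the Def 4.1 (ii) laws HOLD at the tower**: the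
  Galois surjections `Π^tp_X ↠ ℤ ↠ ℤ/N = Aut(X_N)` are natural in `X_N` (`naturalityLaw`, p439630) and have OPEN
  kernels — they contain `Ker(Π^tp_X ↠ ℤ) = Π^tp_Y`, open in the R78 χ-model (`(chiTwistData p).isOpen_ker_toZ`);
* `ToyTower.prop43_i` — **Prop 4.3 (i)** by abc-iut-f-109's `prop43_i_of_galoisSurjNatural` (p428079);
* `ToyTower.rootOverCovering` — **the covering input L01a `RootOverCovering`** (ERRATUM E2) by abc-iut-w4-d044's
  `rootOverCovering_mkOfModelCanonical_of_laws` from the tower laws `rootLaw` / `refinementLaw` (p439630);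
* `ToyTower.sec4_all_typed_tower` — **EVERY typed §4 statement at ONE explicit setting over the genuine Kummer
  tower**: `C` IS a Frobenioid (integral exponents), the Def 4.1 (ii) laws, L01a, Prop 4.2 (i)(ii)(iii)(iv),
  Prop 4.3 (i)(ii)(iii), Thm 4.4 (i)–(iv) for `Ψ = 𝟭` AND for the conjugation-type `(Ψ, Ψ^bs)` with `Ψ^bs ≠ 𝟭`,
  and **Rmk 4.1.1** (p445625) hold SIMULTANEOUSLY — together with the two non-degeneracy certificates (roots of
  `t_1` only upstairs; `Π^tp_X ↠ Aut(X_N) ≅ ℤ/N` onto for every `N`).  Compare `ToyCov.sec4_all_typed` (p429194: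
  the COLLAPSED tower — there Rmk 4.1.1 FAILS, `ToyCov.not_remark411`, and only `Ψ^bs = 𝟭` is available).

READING (neutral): the complete typed §4 statement set INCLUDING Rmk 4.1.1 is jointly consistent with the setting
axioms at a setting free of the collapsed-base artefacts; every landed §4 closer of the cell has a jointly
satisfiable hypothesis list there.  HONEST LIMITS: a toy (𝔾_m, not a Tate curve; trivial [FrdI] vocabularies;
`(N,H)`-slot `True`; Galois datum of the §1 root model acting through `Π^tp_X ↠ ℤ`); consistency ≠ faithfulness;
typed ≠ proved.  Nothing here bears on, or takes a side on, [IUTchIII] Cor. 3.12.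
-/

noncomputable section

namespace Literature.AnabelianGeometry.EtaleTheta

open CategoryTheory Opposite Literature.AlgebraicGeometry.Frobenioids
open scoped NNRat

namespace ToyTower

open Base

variable (p : ℕ) [Fact p.Prime]

/-- **Def 4.1 (ii), naturality, at the tower**: the typed law `GaloisSurjNatural` (= the floor law `hS`,
`ToyTower.naturalityLaw`). [cite: MochizukiEtTh2009, Def 4.1 p.87] -/
theorem galoisSurjNatural : (ToyTower.biKummerSetting p).GaloisSurjNatural := ToyTower.naturalityLaw p

/-- **Def 4.1 (ii), open kernels, at the tower**: `Ker(Π^tp_X ↠ Aut(X_N))` contains the open subgroup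
`Ker(Π^tp_X ↠ ℤ)` of the χ-model. [cite: MochizukiEtTh2009, Def 4.1 p.87] -/
theorem isOpenKerGaloisSurj : (ToyTower.biKummerSetting p).IsOpenKerGaloisSurj := fun A _ => by
  refine Subgroup.isOpen_mono (H₁ := (ToyTower.toZ p).ker) (fun g hg => ?_)
    ((SettingModel.chiTwistData p).isOpen_ker_toZ (SettingModel.continuous_leftRight p))
  rw [MonoidHom.mem_ker] at hg ⊢
  change shiftHom A (ToyTower.toZMod A (ToyTower.toZ p g)) = 1
  rw [hg, map_one, map_one]

/-- **Prop 4.3 (i) HOLDS at the tower** for every transport `pullFrac` (abc-iut-f-109's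
`prop43_i_of_galoisSurjNatural`, `Φ = ℚ_{≥0}` divisorial). [cite: MochizukiEtTh2009, Prop 4.3 p.90] -/
theorem prop43_i (pullFrac : ∀ {A A' : (ToyTower.biKummerSetting p).C} (_ : A' ⟶ A),
      (ToyTower.biKummerSetting p).biratUnits A → (ToyTower.biKummerSetting p).biratUnits A') :
    (ToyTower.biKummerSetting p).Prop43_i pullFrac :=
  BiKummerSetting.prop43_i_of_galoisSurjNatural pullFrac (fun A => ToyTower.divisorMonoid_isDivisorial A)
    (galoisSurjNatural p)

/-- **L01a `RootOverCovering` HOLDS at the tower** (ERRATUM E2: the root lives on the cover `X_{N·M} → X_M`), by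
abc-iut-w4-d044's `rootOverCovering_mkOfModelCanonical_of_laws` from `rootLaw` and `refinementLaw`.
[cite: MochizukiEtTh2009, Prop 4.2 p.89] -/
theorem rootOverCovering :
    BiKummerSetting.Prop42Sub.RootOverCovering (ToyTower.biKummerSetting p)
      (fun {_ _} φ x => ToyTower.temperedFrobenioid.pullFracModel φ x) :=
  BiKummerSetting.Prop42Sub.rootOverCovering_mkOfModelCanonical_of_laws (ToyTower.temperedGroup p)
    ToyTower.temperedFrobenioid ToyTower.temperedFrobenioid_monoidType ToyTower.temperedFrobenioid_isPerfect
    (fun _ => True) (ToyTower.galoisSurj p) (ToyTower.galoisSurj_surjective p) (fun _ _ _ => True) ToyTower.Aodot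
    ToyTower.isFrobeniusTrivial_Aodot trivial ToyTower.divisorMonoid_isDivisorial ToyTower.rootLaw
    ToyTower.refinementLaw

/-- **ALL typed §4 statements at ONE explicit setting over the GENUINE Kummer tower** (`ToyTower.biKummerSetting p`,
transport `pullFracModel`): `C` IS a Frobenioid with integral exponents; the uniformiser has a square root only
upstairs; every `Π^tp_X ↠ Aut(X_N) ≅ ℤ/N` is onto; the Def 4.1 (ii) laws; L01a; Prop 4.2 (i), (ii), (iii), (iv);
Prop 4.3 (i), (ii), (iii); Thm 4.4 (i)–(iv) for `Ψ = 𝟭` and for `(conj, negBase)` with `Ψ^bs ≠ 𝟭`; and Rmk 4.1.1 —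
SIMULTANEOUSLY. [cite: MochizukiEtTh2009, Thm 4.4 p.94] -/
theorem sec4_all_typed_tower :
    PreFrobenioid.IsFrobenioid ToyTower.temperedFrobenioid.toElem ∧
      ((¬ ∃ g : ToyTower.temperedFrobenioid.ratFnFunctor.obj (op (⟨1⟩ : ToyTower.Base)),
          g ^ 2 = ToyTower.unif ⟨1⟩) ∧
        ∃ g : ToyTower.temperedFrobenioid.ratFnFunctor.obj (op (ToyTower.coverObj ⟨1⟩ 2)),
          g ^ 2 = pull ToyTower.temperedFrobenioid.ratFnFunctor (ToyTower.cover ⟨1⟩ 2) (ToyTower.unif ⟨1⟩)) ∧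
      (∀ A : ToyTower.Base, Function.Surjective (ToyTower.galoisSurj p A trivial) ∧ Nonempty (Aut A ≃ ZMod A.lvl)) ∧
      (ToyTower.biKummerSetting p).GaloisSurjNatural ∧ (ToyTower.biKummerSetting p).IsOpenKerGaloisSurj ∧
      BiKummerSetting.Prop42Sub.RootOverCovering (ToyTower.biKummerSetting p)
        (fun {_ _} φ x => ToyTower.temperedFrobenioid.pullFracModel φ x) ∧
      (ToyTower.biKummerSetting p).Prop42_i ∧ (ToyTower.biKummerSetting p).Prop42_ii ∧
      (ToyTower.biKummerSetting p).Prop42_iii (fun {_ _} φ x => ToyTower.temperedFrobenioid.pullFracModel φ x) ∧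
      (ToyTower.biKummerSetting p).Prop42_iv (fun φ x => ToyTower.temperedFrobenioid.pullFracModel φ x) ∧
      ((ToyTower.biKummerSetting p).Prop43_i fun {_ _} φ => ToyTower.temperedFrobenioid.pullFracModel φ) ∧
      ((ToyTower.biKummerSetting p).Prop43_ii fun {_ _} φ => ToyTower.temperedFrobenioid.pullFracModel φ) ∧
      ((ToyTower.biKummerSetting p).Prop43_iii fun {_ _} φ => ToyTower.temperedFrobenioid.pullFracModel φ) ∧
      (∃ (h : BiKummerSetting.Thm44Hyp (ToyTower.biKummerSetting p) (ToyTower.biKummerSetting p))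
        (ψ : ∀ A : (ToyTower.biKummerSetting p).C,
          (ToyTower.biKummerSetting p).biratUnits A ≃* (ToyTower.biKummerSetting p).biratUnits (h.Ψ.functor.obj A)),
        BiKummerSetting.Thm44_i h ∧ BiKummerSetting.Thm44_ii h ψ ∧ BiKummerSetting.Thm44_iii h ψ ∧
          BiKummerSetting.Thm44_iv h ψ (fun {_ _} φ => ToyTower.temperedFrobenioid.pullFracModel φ)
            (fun {_ _} φ => ToyTower.temperedFrobenioid.pullFracModel φ)) ∧
      (ToyTower.negBase.map (shiftIso (⟨3⟩ : ToyTower.Base) 1).hom ≠ (shiftIso ⟨3⟩ 1).hom ∧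
        BiKummerSetting.Thm44_i (ToyTower.thm44HypConj p) ∧
        BiKummerSetting.Thm44_ii (ToyTower.thm44HypConj p) (ToyTower.ψConj p) ∧
        BiKummerSetting.Thm44_iii (ToyTower.thm44HypConj p) (ToyTower.ψConj p) ∧
        BiKummerSetting.Thm44_iv (ToyTower.thm44HypConj p) (ToyTower.ψConj p)
          (fun {_ _} φ => ToyTower.temperedFrobenioid.pullFracModel φ)
          (fun {_ _} φ => ToyTower.temperedFrobenioid.pullFracModel φ)) ∧
      (ToyTower.biKummerSetting p).Remark411 :=
  ⟨ToyTower.temperedFrobenioid_isFrobenioid, (ToyTower.roots_only_upstairs ⟨1⟩).2,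
    (ToyTower.sec4_picture_tower p).2.2.1, galoisSurjNatural p, isOpenKerGaloisSurj p, rootOverCovering p,
    (ToyTower.prop42_i_and_ii p).1, (ToyTower.prop42_i_and_ii p).2, (ToyTower.laws_and_prop42_iii_iv p).2.2.1,
    (ToyTower.laws_and_prop42_iii_iv p).2.2.2,
    prop43_i p (fun {_ _} φ => ToyTower.temperedFrobenioid.pullFracModel φ), ToyTower.prop43_ii p, ToyTower.prop43_iii p,
    ToyTower.thm44_id p, ToyTower.thm44_conj p, ToyTower.remark411 p⟩

end ToyTower

end Literature.AnabelianGeometry.EtaleTheta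

end
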